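import Summits.RiemannHypothesis.RiemannHypothesis.Theorems.IntegerScrewCensusFastRowsLemmas

/-!
# Route `IntegerScrew` — fast kernel arithmetic for manifest-certificate checks (4d): the row invariant

`rows_err`: if the range flag of `Fast.rows tcList logs τ js n` is set, the log table encloses `log m` for
`2 ≤ m ≤ n+1` with widths `≤ Wmax`, and the per-atom units `U_k = (32 j_k Wmax/τ + 14)/2^52` satisfy `U_k ≤ 1/26`
(`16 j_k Wmax/τ + 5 ≤ 2^60` a fortiori), then EVERY stored value is close to the true one:
`‖ẑ_{k,m} − e^{i (j_k/τ) log m}‖ ≤ (2 d(m) − 1)·U_k ≤ 15·U_k` (`d(m) ≤ 8` the stored depth).  Induction over the builder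
with the numeric steps `base_err` / `composite_err` (`…FastRowsErr`) and the plumbing of `…FastRowsLemmas`.
This is the trig half of `manifestCert_of_fastCheck` (HOME/sos/CENSUS-KERNEL-IMPORT-engA.md §4).
RH-free; nothing here bears on the truth of RH.
-/

set_option linter.dupNamespace false
set_option autoImplicit false

namespace Summit.RiemannHypothesis.RiemannHypothesis.Theorems.IntegerScrew.Manifest.Fast

open Finset

/-- The true value `e^{i (j/τ) log m}`. [folklore] -/
noncomputable def zT (τ j m : ℕ) : ℂ := Complex.exp ((((j : ℝ) / τ * Real.log m : ℝ) : ℂ) * Complex.I)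

/-- A stored row `(d, row)` at node `m` is CORRECT: `1 ≤ d ≤ 8`, full length, and every entry within
`(2d − 1)·U_k` of the true value. [folklore] -/
def RowOK (Wmax τ : ℕ) (js : List ℕ) (m : ℕ) (dr : ℕ × List (ℕ × ℕ)) : Prop :=
  1 ≤ dr.1 ∧ dr.1 ≤ 8 ∧ dr.2.length = js.length ∧
    ∀ k, k < js.length →
      ‖zOf (dr.2.getD k (0, 0)).1 (dr.2.getD k (0, 0)).2 - zT τ (js.getD k 0) m‖ ≤
        (2 * dr.1 - 1 : ℝ) * Uk Wmax τ (js.getD k 0)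

/-- The accumulator invariant: every node `2 ≤ m < length` is correct, and the base nodes (fixed points of
`smallFactor`) have depth `1`. [folklore] -/
def AccOK (Wmax τ : ℕ) (js : List ℕ) (acc : List (ℕ × List (ℕ × ℕ))) : Prop :=
  ∀ m, 2 ≤ m → m < acc.length →
    RowOK Wmax τ js m (acc.getD m (0, [])) ∧ (smallFactor m = m → (acc.getD m (0, [])).1 = 1)

/-- The log enclosure read through `logLoW`: `L ≤ 2^48 log m ≤ L + W`. -/
theorem logLoW_spec {logs : List Literature.Analysis.ValidatedNumerics.Numerics.FI} {m : ℕ}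
    (h : Literature.Analysis.ValidatedNumerics.Numerics.FI.mem (Real.log m)
      (logs.getD m (Literature.Analysis.ValidatedNumerics.Numerics.FI.ofInt 0))) :
    ((logLoW logs m).1 : ℝ) ≤ 2 ^ 48 * Real.log m ∧ 2 ^ 48 * Real.log m ≤ ((logLoW logs m).1 : ℝ) + (logLoW logs m).2 := by
  obtain ⟨h1, h2⟩ := h
  have hSC : (Literature.Analysis.ValidatedNumerics.Numerics.SC : ℝ) = 2 ^ 48 := by
    norm_num [Literature.Analysis.ValidatedNumerics.Numerics.SC]
  rw [hSC] at h1 h2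
  set I := logs.getD m (Literature.Analysis.ValidatedNumerics.Numerics.FI.ofInt 0) with hI
  unfold logLoW
  rw [← hI]
  simp only
  have hlohi : I.lo ≤ I.hi := by exact_mod_cast h1.trans h2
  rcases le_or_gt 0 I.lo with hlo | hlo
  · have e1 : ((I.lo.toNat : ℕ) : ℝ) = (I.lo : ℝ) := by exact_mod_cast Int.toNat_of_nonneg hlo
    have e2 : (((I.hi - I.lo).toNat : ℕ) : ℝ) = (I.hi : ℝ) - I.lo := by
      have := Int.toNat_of_nonneg (sub_nonneg.2 hlohi); exact_mod_cast this
    rw [e1, e2]; constructor <;> linarith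
  · have e1 : ((I.lo.toNat : ℕ) : ℝ) = 0 := by
      rw [Int.toNat_of_nonpos hlo.le]; simp
    have e2 : (((I.hi - I.lo).toNat : ℕ) : ℝ) = (I.hi : ℝ) - I.lo := by
      have := Int.toNat_of_nonneg (sub_nonneg.2 hlohi); exact_mod_cast this
    have hlo' : (I.lo : ℝ) < 0 := by exact_mod_cast hlo
    have hlog : 0 ≤ Real.log (m : ℝ) := Real.log_natCast_nonneg m
    rw [e1, e2]; constructor <;> linarith

section Invariant

variable {logs : List Literature.Analysis.ValidatedNumerics.Numerics.FI} {τ n Wmax : ℕ} {js : List ℕ}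

/-- **The induction over the builder.** -/
theorem buildRows_inv (hτ : 0 < τ)
    (hlogs : ∀ m, 2 ≤ m → m ≤ n + 1 →
      Literature.Analysis.ValidatedNumerics.Numerics.FI.mem (Real.log m)
        (logs.getD m (Literature.Analysis.ValidatedNumerics.Numerics.FI.ofInt 0)) ∧ (logLoW logs m).2 ≤ Wmax)
    (hU : ∀ k, k < js.length → Uk Wmax τ (js.getD k 0) ≤ 1 / 26) :
    ∀ (fuel : ℕ) (acc : List (ℕ × List (ℕ × ℕ))) (ok : Bool), AccOK Wmax τ js acc →
      acc.length + fuel ≤ n + 2 → (buildRows tcList logs τ js fuel acc ok).2 = true →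
      AccOK Wmax τ js (buildRows tcList logs τ js fuel acc ok).1 := by
  intro fuel
  induction fuel with
  | zero => intro acc ok hacc _ _; simp only [buildRows]; exact hacc
  | succ fuel ih =>
    intro acc ok hacc hlen hflag
    have hS0 : (0 : ℝ) < SCL := by norm_num [SCL]
    have hUlo : ∀ k, k < js.length → (14 : ℝ) / SCL ≤ Uk Wmax τ (js.getD k 0) := by
      intro k _
      unfold Uk
      refine div_le_div_of_nonneg_right ?_ hS0.le
      have : (0 : ℝ) ≤ 32 * (js.getD k 0 : ℝ) * Wmax / τ := by positivity
      linarith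
    -- generic step: extending `acc` by a row that is correct at node `acc.length`
    have hext : ∀ (x : ℕ × List (ℕ × ℕ)),
        (2 ≤ acc.length → RowOK Wmax τ js acc.length x ∧ (smallFactor acc.length = acc.length → x.1 = 1)) →
        AccOK Wmax τ js (acc ++ [x]) := by
      intro x hx m hm2 hm
      simp only [List.length_append, List.length_singleton] at hm
      rcases Nat.lt_or_ge m acc.length with hlt | hge
      · rw [List.getD_append _ _ _ _ hlt]; exact hacc m hm2 hlt
      · have hm' : m = acc.length := by omega
        subst hm'
        have hget : (acc ++ [x]).getD acc.length (0, []) = x := by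
          simp [List.getD_eq_getElem?_getD]
        rw [hget]; exact hx hm2
    simp only [buildRows] at hflag ⊢
    split_ifs at hflag ⊢ with hm hp
    · -- placeholder rows `m < 2`
      exact ih _ _ (hext _ fun h2 => absurd hm (by omega)) (by simp; omega) hflag
    · -- base node
      have hr1 : (primeRow tcList (logLoW logs acc.length).1 τ js).1 = true := by
        have := buildRows_flag_mono tcList logs τ js fuel _ _ hflag
        rw [Bool.and_eq_true] at this; exact this.2
      refine ih _ _ (hext _ fun h2 => ⟨?_, fun _ => rfl⟩) (by simp; omega) hflag
      have hmle : acc.length ≤ n + 1 := by omega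
      obtain ⟨hmem, hW⟩ := hlogs acc.length h2 hmle
      obtain ⟨hlo, hhi⟩ := logLoW_spec hmem
      refine ⟨le_rfl, by norm_num, primeRow_length _ _ _ _, fun k hk => ?_⟩
      obtain ⟨hget, hfl⟩ := primeRow_get tcList (logLoW logs acc.length).1 τ js k hk
      rw [hget]
      have hUk := hU k hk
      have hE : (16 * (js.getD k 0) * Wmax : ℝ) / τ + 5 ≤ 2 ^ 60 := by
        unfold Uk at hUk
        have h26 := (div_le_div_iff₀ hS0 (by norm_num : (0:ℝ) < 26)).1 hUk
        have hSv : (SCL : ℝ) = 2 ^ 52 := by norm_num [SCL]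
        rw [hSv] at h26
        have h16 : (16 * (js.getD k 0) * Wmax : ℝ) / τ = (32 * (js.getD k 0 : ℝ) * Wmax / τ) / 2 := by ring
        rw [h16]
        nlinarith
      have hb := base_err (m := acc.length) hτ hlo hhi hW hE (hfl hr1)
      have e : (2 * ((1 : ℕ) : ℝ) - 1) * Uk Wmax τ (js.getD k 0) = Uk Wmax τ (js.getD k 0) := by norm_num
      rw [e]
      unfold zT
      exact hb
    · -- composite node `m = p · (m/p)`
      have hm2 : 2 ≤ acc.length := by omega
      obtain ⟨hmul, hplt, hq2, hqlt⟩ := smallFactor_split hm2 hp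
      have hp2 := two_le_smallFactor hm2
      set p := smallFactor acc.length with hpdef
      set q := acc.length / p with hqdef
      obtain ⟨hRa, hda⟩ := hacc p hp2 hplt
      obtain ⟨hRb, _⟩ := hacc q hq2 hqlt
      have ha1 : (acc.getD p (0, [])).1 = 1 := hda (by rw [hpdef]; exact smallFactor_idem _)
      have hdep : (acc.getD q (0, [])).1 + 1 ≤ 8 := by
        have := buildRows_flag_mono tcList logs τ js fuel _ _ hflag
        rw [Bool.and_eq_true, Nat.ble_eq] at this; exact this.2
      refine ih _ _ (hext _ fun _ => ⟨?_, fun h => absurd h hp⟩) (by simp; omega) hflag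
      obtain ⟨hb1, hb8, hblen, hberr⟩ := hRb
      obtain ⟨_, _, halen, haerr⟩ := hRa
      refine ⟨by omega, hdep, ?_, fun k hk => ?_⟩
      · rw [stepRow_length, halen, hblen, Nat.min_self]
      · rw [stepRow_get _ _ k (by omega) (by omega)]
        have h1 := haerr k hk
        rw [ha1] at h1
        have e1 : (2 * ((1 : ℕ) : ℝ) - 1) * Uk Wmax τ (js.getD k 0) = Uk Wmax τ (js.getD k 0) := by norm_num
        have h1' : ‖zOf ((acc.getD p (0, [])).2.getD k (0, 0)).1 ((acc.getD p (0, [])).2.getD k (0, 0)).2 -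
            zT τ (js.getD k 0) p‖ ≤ Uk Wmax τ (js.getD k 0) := by
          rw [← e1]; exact h1
        have h2 := hberr k hk
        have hc := composite_err h1' h2 (by unfold zT; exact norm_exp_real_mul_I _)
          (by unfold zT; exact norm_exp_real_mul_I _) hb1 (by omega) (hUlo k hk) (hU k hk)
        have hzz : zT τ (js.getD k 0) p * zT τ (js.getD k 0) q = zT τ (js.getD k 0) acc.length := by
          unfold zT
          have hm' : ((acc.length : ℕ) : ℝ) = ((p * q : ℕ) : ℝ) := by rw [hmul]
          rw [hm', ← exp_log_mul (by omega) (by omega)]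
        rw [hzz] at hc
        exact hc

/-- **Row invariant of `rows`.**  Under the hypotheses of `buildRows_inv`, every node `2 ≤ m ≤ n+1` of
`Fast.rows tcList logs τ js n` carries a correct row; in particular each stored value is within `15·U_k` of
`e^{i (j_k/τ) log m}`. -/
theorem rows_err (hτ : 0 < τ)
    (hlogs : ∀ m, 2 ≤ m → m ≤ n + 1 →
      Literature.Analysis.ValidatedNumerics.Numerics.FI.mem (Real.log m)
        (logs.getD m (Literature.Analysis.ValidatedNumerics.Numerics.FI.ofInt 0)) ∧ (logLoW logs m).2 ≤ Wmax)
    (hU : ∀ k, k < js.length → Uk Wmax τ (js.getD k 0) ≤ 1 / 26)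
    (hflag : (rows tcList logs τ js n).2 = true) {m : ℕ} (hm2 : 2 ≤ m) (hm : m ≤ n + 1) :
    RowOK Wmax τ js m ((rows tcList logs τ js n).1.getD m (0, [])) := by
  have hinv := buildRows_inv hτ hlogs hU (n + 2) [] true (fun m _ h => absurd h (by simp)) (by simp) hflag
  have hlt : m < (buildRows tcList logs τ js (n + 2) [] true).1.length := by
    rw [buildRows_length]; simp; omega
  exact (hinv m hm2 hlt).1

end Invariant

end Summit.RiemannHypothesis.RiemannHypothesis.Theorems.IntegerScrew.Manifest.Fast
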